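import Summits.QuantumFields.BalabanUV.Beta.FP.ResidualModeLoewner
import Mathlib.Analysis.Normed.Ring.Units

/-!
# `BalabanUV.Beta.FP.CoarseFormSemigroup` — road «FP» for binder row D1, row **RHOA-1b** (owner d1-p3-g6, ROW BOOKKEEPING journal l.23656; LEAVES-FP l.346):
# THE EFFECTIVE (BLOCK) FORM IS THE CONSTRAINED-MINIMUM VALUE FORM — `aᵀ·effForm H Q·a = min{φᵀHφ : Qφ = a}` — its positivity, the ε-REGULARISED
# SCHUR-COMPLEMENT reading for a singular fine form, and the composition law read as nested minimisation

HONEST DEPENDENCY (page 1, mandatory): continuum YM on T⁴ ⇐ BetaPertH ∧ nine spine estimates (0/9 proved); BetaPertH ⇐ (D1) ∧ (D4) ∧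
CAP+tail; G-an2-4 gates asym, D1 and NE2/3/4.  HONEST FRAMING (cell contract, verbatim): «discharging `BetaPertH` makes Bałaban's UV
stability UNCONDITIONAL — a real constructive-QFT result; it is NOT the continuum limit and NOT the Clay problem.»  THIS MODULE is [folklore]
finite-dimensional linear algebra over `ℝ` on the cell's bordered dictionary (`Beta.Composition.kkt ∕ blockProp ∕ compForm`,
`Beta.CompositionSingular.effForm ∕ minOp`) plus ONE continuity-of-the-inverse socket (Mathlib `continuousAt_matrix_inv`, entrywise topology — no matrix norm
instance, no order instance: Loewner statements are written `(A − B).PosSemidef` as in `FP/ResidualModeIdentities`).  Every hypothesis is displayed; no `def`,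
no `def … : Prop`, nothing cited, 0 sorry; 0 estimates of Bałaban's; 0∕4 row-D1 binders; NOT hbook, NOT D1, NOT BetaPertH, NOT continuum, NOT Clay.
ABSOLUTE RULE (cell charter, verbatim): «No internally-minted statement may enter as a cited fact. Every hypothesis is either kernel-proved in this
package or a verbatim quotation of a PUBLISHED theorem with page reference. The manuscript(s) under audit are NOT citable for their own disputed
steps — they are the thing under adjudication; programme-internal (2001/route/tribunal) claims are never citable.»

WHY (RHOA-DESIGN §1, N7-PROOF v3.3 §2; owner l.23656 «RHOA-1b = the remaining half: the effective form IS the constrained-minimum value form … for `H ⪰ 0` on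
`ker Q` with invertible bordering, + the ε-regularised Schur-complement reading for singular `H₀`»; `CompositionSingular`'s header lists exactly this
positivity ∕ variational statement as «not proved»).  The one shot of road FP borders a SINGULAR fine form (`H₀ = Δ₁(B)` kills the residual gauge directions);
`CompositionSingular` reads the effective form `effForm H Q := −((kkt H Q)⁻¹)₂₂` off the bordered inverse and proves the algebra (Euler–Lagrange, value identity,
composition law `effForm_compForm`) for every field.  Over `ℝ` this file supplies the ANALYSIS that the RHOA rows (RHOA-9's `H‴`, RHOA-1a's saturated slices) quote:
(1) the value identity is a MINIMUM as soon as `H ⪰ 0` on `ker Q`; (2) for a PSD fine form the effective form is PSD, and PD exactly when the fine form is;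
(3) for a PSD singular `H₀` the effective form is the LIMIT of the honest Schur complements `(Q(H₀ + ε)⁻¹Qᵀ)⁻¹`, `ε ↓ 0`; (4) two steps = one step, as nested minima.

CONTENT (`H : Matrix ν ν ℝ`, `Q : Matrix μ ν ℝ`, `h : IsUnit (kkt H Q).det` throughout):
* §1 THE VARIATIONAL READING — `constraint_minOp` (`Q·(ℋa) = a`), `effForm_quadForm_eq` (`aᵀ𝒮a = (ℋa)ᵀH(ℋa)`: the value is ATTAINED), `quadForm_split`
  (`Hᵀ = H`, `Qz = 0`: `(ℋa + z)ᵀH(ℋa + z) = aᵀ𝒮a + zᵀHz`), **`effForm_quadForm_le`** (`H ⪰ 0` on `ker Q`, `Qφ = a ⟹ aᵀ𝒮a ≤ φᵀHφ`), **`isLeast_effForm`**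
  (`IsLeast {φᵀHφ : Qφ = a} (aᵀ𝒮a)` — «`aᵀ·effForm·a = min{φᵀHφ : Qφ = a}`» literally), `eq_minOp_of_quadForm_eq` (STRICT positivity on `ker Q`: the minimiser
  is unique), **`effForm_mono`** (`H ⪯ H′` ⟹ `𝒮 ⪯ 𝒮′`).
* §2 POSITIVITY — `transpose_mulVec_injective` (`Qᵀ` injective), **`effForm_posSemidef`** (`H ⪰ 0 ⟹ 𝒮 ⪰ 0`), `effForm_posDef_of_posDef`,
  **`effForm_posDef_iff`** (`H ⪰ 0` ⟹ (`𝒮 ≻ 0 ⟺ H ≻ 0`) — LOCATED: a kernel vector `x ≠ 0` of a PSD `H` has `Qx ≠ 0` (else `kkt·(x,0) = 0`) and value `0` at `a = Qx`),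
  and the COUNTEREXAMPLE `example_not_posSemidef` (`H = diag(−1,1)`, `Q = (1 0)`, written out, no `def`: bordering invertible, `H ≻ 0` on `ker Q`, `effForm = (−1)`): «`H ⪰ 0` on `ker Q`»
  gives the minimum reading, NOT positivity.
* §3 THE ε-REGULARISED SCHUR COMPLEMENT — `kkt_add_smul_one`, **`tendsto_effForm_add_smul`** (`h` only: `effForm (H + ε•1) Q → effForm H Q`, `ε → 0`),
  `isUnit_reg_of_posSemidef` (`H ⪰ 0`, `0 < ε`: `H + ε•1` and `blockProp (H + ε•1) Q = Q(H + ε)⁻¹Qᵀ` invertible), **`tendsto_blockProp_inv_of_posSemidef`**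
  (`H ⪰ 0`: `(Q(H + ε•1)⁻¹Qᵀ)⁻¹ → effForm H Q` as `ε ↓ 0`).
* §4 THE SEMIGROUP AS NESTED MINIMISATION — **`isLeast_effForm_comp`**: the two-step value `bᵀ·effForm (H + Q₁ᵀGQ₁) (Q₂Q₁)·b` is the ONE-step minimum of
  `aᵀ(effForm H Q₁ + G)a` over `Q₂a = b` (`CompositionSingular.effForm_compForm` + §1).
Provenance: NE9 formalisation swarm, unit b2b-balaban-t4-ne9-formalise-leaf-03 gen 31 (prover-b2b-balaban-t4-ne9-formalise-leaf-03-g31-0), 2026-08-21, cross-lane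
duty NE9 → road FP, row RHOA-1b.  [folklore], 0 def, 0 cite, 0 sorry.
-/

noncomputable section

namespace Summit.QuantumFields.BalabanUV.Beta.FP.CoarseFormSemigroup

open scoped Matrix Topology
open Matrix Filter
open Literature.MathematicalPhysics.QuantumFieldTheory.Balaban1983to89.Beta.Composition (kkt blockProp compForm)
open Literature.MathematicalPhysics.QuantumFieldTheory.Balaban1983to89.Beta.CompositionSingular
  (effForm minOp kkt_eq_fromBlocks kkt_mul_blocks transpose_minOp_mul_mul_minOp minOpL_eq_transpose effForm_eq_blockProp_inv effForm_compForm)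
open Summit.QuantumFields.BalabanUV.Beta.FP.ResidualModeIdentities (dotProduct_mulVec_sq_le)
open Summit.QuantumFields.BalabanUV.Beta.FP.ResidualModeLoewner (posDef_smul_of_pos)

variable {ν μ κ : Type*} [Fintype ν] [Fintype μ] [Fintype κ] [DecidableEq ν] [DecidableEq μ] [DecidableEq κ]

/-! ## §1 The variational reading: `aᵀ·effForm H Q·a = min{φᵀHφ : Qφ = a}` -/

omit [DecidableEq κ] [Fintype κ] in
/-- [folklore] The minimiser satisfies the constraint: `Q·(minOp H Q·a) = a`. -/
theorem constraint_minOp (H : Matrix ν ν ℝ) (Q : Matrix μ ν ℝ) (h : IsUnit (kkt H Q).det) (a : μ → ℝ) :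
    Q *ᵥ (minOp H Q *ᵥ a) = a := by
  rw [mulVec_mulVec, (kkt_mul_blocks H Q h).2.2.2, one_mulVec]

omit [DecidableEq κ] [Fintype κ] in
/-- [folklore] Euler–Lagrange in vector form: `H·(minOp·a) = Qᵀ·(effForm·a)`. -/
theorem mulVec_minOp (H : Matrix ν ν ℝ) (Q : Matrix μ ν ℝ) (h : IsUnit (kkt H Q).det) (a : μ → ℝ) :
    H *ᵥ (minOp H Q *ᵥ a) = Qᵀ *ᵥ (effForm H Q *ᵥ a) := by
  rw [mulVec_mulVec, mulVec_mulVec, (kkt_mul_blocks H Q h).2.1]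

omit [DecidableEq κ] [Fintype κ] in
/-- [folklore] **THE VALUE IS ATTAINED**: `aᵀ·effForm H Q·a = (minOp·a)ᵀ H (minOp·a)` (no symmetry of `H` needed). -/
theorem effForm_quadForm_eq (H : Matrix ν ν ℝ) (Q : Matrix μ ν ℝ) (h : IsUnit (kkt H Q).det) (a : μ → ℝ) :
    a ⬝ᵥ effForm H Q *ᵥ a = (minOp H Q *ᵥ a) ⬝ᵥ H *ᵥ (minOp H Q *ᵥ a) := by
  rw [← transpose_minOp_mul_mul_minOp H Q h, ← mulVec_mulVec, ← mulVec_mulVec, dotProduct_mulVec a (minOp H Q)ᵀ,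
    vecMul_transpose]

omit [DecidableEq κ] [Fintype κ] in
/-- [folklore] a fluctuation is `H`-orthogonal to the background field: `Qz = 0 ⟹ zᵀ·H·(minOp·a) = 0`. -/
theorem fluct_dotProduct_mulVec_minOp (H : Matrix ν ν ℝ) (Q : Matrix μ ν ℝ) (h : IsUnit (kkt H Q).det) (a : μ → ℝ) {z : ν → ℝ}
    (hz : Q *ᵥ z = 0) : z ⬝ᵥ H *ᵥ (minOp H Q *ᵥ a) = 0 := by
  rw [mulVec_minOp H Q h a, dotProduct_mulVec, vecMul_transpose, hz, zero_dotProduct]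

omit [DecidableEq κ] [Fintype κ] in
/-- [folklore] **THE BACKGROUND-FIELD SPLIT, vector form** (`H` symmetric): for `Qz = 0`,
`(minOp·a + z)ᵀ H (minOp·a + z) = aᵀ·effForm·a + zᵀHz` — no cross term. -/
theorem quadForm_split (H : Matrix ν ν ℝ) (Q : Matrix μ ν ℝ) (hH : Hᵀ = H) (h : IsUnit (kkt H Q).det) (a : μ → ℝ) {z : ν → ℝ}
    (hz : Q *ᵥ z = 0) :
    (minOp H Q *ᵥ a + z) ⬝ᵥ H *ᵥ (minOp H Q *ᵥ a + z) = a ⬝ᵥ effForm H Q *ᵥ a + z ⬝ᵥ H *ᵥ z := by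
  have h1 : z ⬝ᵥ H *ᵥ (minOp H Q *ᵥ a) = 0 := fluct_dotProduct_mulVec_minOp H Q h a hz
  have h2 : (minOp H Q *ᵥ a) ⬝ᵥ H *ᵥ z = 0 := by
    rw [dotProduct_mulVec, ← mulVec_transpose, hH, dotProduct_comm]; exact h1
  rw [mulVec_add, dotProduct_add, add_dotProduct, add_dotProduct, h1, h2, effForm_quadForm_eq H Q h a]; ring

omit [DecidableEq κ] [Fintype κ] in
/-- [folklore] **THE EFFECTIVE FORM IS BELOW EVERY COMPETITOR**: `H` symmetric and `H ⪰ 0` on `ker Q` (`hker`), bordering invertible ⟹ for every `φ` with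
`Qφ = a`: `aᵀ·effForm H Q·a ≤ φᵀHφ`. -/
theorem effForm_quadForm_le (H : Matrix ν ν ℝ) (Q : Matrix μ ν ℝ) (hH : Hᵀ = H) (h : IsUnit (kkt H Q).det)
    (hker : ∀ z : ν → ℝ, Q *ᵥ z = 0 → 0 ≤ z ⬝ᵥ H *ᵥ z) (a : μ → ℝ) (φ : ν → ℝ) (hφ : Q *ᵥ φ = a) :
    a ⬝ᵥ effForm H Q *ᵥ a ≤ φ ⬝ᵥ H *ᵥ φ := by
  have hz : Q *ᵥ (φ - minOp H Q *ᵥ a) = 0 := by rw [mulVec_sub, hφ, constraint_minOp H Q h a, sub_self]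
  have e : φ = minOp H Q *ᵥ a + (φ - minOp H Q *ᵥ a) := by abel
  rw [e, quadForm_split H Q hH h a hz]
  linarith [hker _ hz]

omit [DecidableEq κ] [Fintype κ] in
/-- [folklore] **`aᵀ·effForm H Q·a = min{φᵀHφ : Qφ = a}`**, literally: the value is the LEAST element of the set of competitor values. -/
theorem isLeast_effForm (H : Matrix ν ν ℝ) (Q : Matrix μ ν ℝ) (hH : Hᵀ = H) (h : IsUnit (kkt H Q).det)
    (hker : ∀ z : ν → ℝ, Q *ᵥ z = 0 → 0 ≤ z ⬝ᵥ H *ᵥ z) (a : μ → ℝ) :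
    IsLeast {t : ℝ | ∃ φ : ν → ℝ, Q *ᵥ φ = a ∧ t = φ ⬝ᵥ H *ᵥ φ} (a ⬝ᵥ effForm H Q *ᵥ a) :=
  ⟨⟨minOp H Q *ᵥ a, constraint_minOp H Q h a, effForm_quadForm_eq H Q h a⟩,
    fun _ ⟨φ, hφ, ht⟩ => ht ▸ effForm_quadForm_le H Q hH h hker a φ hφ⟩

omit [DecidableEq κ] [Fintype κ] in
/-- [folklore] **UNIQUENESS OF THE MINIMISER** under STRICT positivity of `H` on `ker Q`: a competitor attaining the value IS `minOp·a`. -/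
theorem eq_minOp_of_quadForm_eq (H : Matrix ν ν ℝ) (Q : Matrix μ ν ℝ) (hH : Hᵀ = H) (h : IsUnit (kkt H Q).det)
    (hker' : ∀ z : ν → ℝ, Q *ᵥ z = 0 → z ≠ 0 → 0 < z ⬝ᵥ H *ᵥ z) (a : μ → ℝ) (φ : ν → ℝ) (hφ : Q *ᵥ φ = a)
    (heq : φ ⬝ᵥ H *ᵥ φ = a ⬝ᵥ effForm H Q *ᵥ a) : φ = minOp H Q *ᵥ a := by
  have hz : Q *ᵥ (φ - minOp H Q *ᵥ a) = 0 := by rw [mulVec_sub, hφ, constraint_minOp H Q h a, sub_self]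
  have e : φ = minOp H Q *ᵥ a + (φ - minOp H Q *ᵥ a) := by abel
  have hsplit := quadForm_split H Q hH h a hz
  rw [← e, heq] at hsplit
  by_contra hne
  have hpos := hker' _ hz (sub_ne_zero.mpr hne)
  linarith

omit [DecidableEq κ] [Fintype κ] in
/-- [folklore] **MONOTONICITY**: `H`, `H′` symmetric, both borderings invertible, `H ⪰ 0` on `ker Q`, `(H′ − H) ⪰ 0` ⟹ `(effForm H′ Q − effForm H Q) ⪰ 0`
— the minimum of a larger form is larger. -/
theorem effForm_mono (H H' : Matrix ν ν ℝ) (Q : Matrix μ ν ℝ) (hH : Hᵀ = H) (hH' : H'ᵀ = H') (h : IsUnit (kkt H Q).det)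
    (h' : IsUnit (kkt H' Q).det) (hker : ∀ z : ν → ℝ, Q *ᵥ z = 0 → 0 ≤ z ⬝ᵥ H *ᵥ z) (hle : (H' - H).PosSemidef) :
    (effForm H' Q - effForm H Q).PosSemidef := by
  have hS : (effForm H Q)ᵀ = effForm H Q := (minOpL_eq_transpose H Q hH).2.2
  have hS' : (effForm H' Q)ᵀ = effForm H' Q := (minOpL_eq_transpose H' Q hH').2.2
  refine PosSemidef.of_dotProduct_mulVec_nonneg ?_ fun x => ?_
  · rw [IsHermitian, conjTranspose_eq_transpose_of_trivial, transpose_sub, hS, hS']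
  · rw [star_trivial, sub_mulVec, dotProduct_sub, sub_nonneg, effForm_quadForm_eq H' Q h' x]
    have h1 := effForm_quadForm_le H Q hH h hker x (minOp H' Q *ᵥ x) (constraint_minOp H' Q h' x)
    have h2 : 0 ≤ (minOp H' Q *ᵥ x) ⬝ᵥ (H' - H) *ᵥ (minOp H' Q *ᵥ x) := by
      simpa using hle.dotProduct_mulVec_nonneg (minOp H' Q *ᵥ x)
    rw [sub_mulVec, dotProduct_sub] at h2
    linarith

/-! ## §2 Positivity: `H ⪰ 0 ⟹ effForm ⪰ 0`; for PSD `H`, `effForm ≻ 0 ⟺ H ≻ 0`; the «`H ⪰ 0` on `ker Q`» counterexample -/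

omit [DecidableEq κ] [Fintype κ] in
/-- [folklore] invertible bordering ⟹ `Qᵀ` is injective (`Q` is onto: `Q·minOp = 1`). -/
theorem transpose_mulVec_injective (H : Matrix ν ν ℝ) (Q : Matrix μ ν ℝ) (h : IsUnit (kkt H Q).det) :
    Function.Injective (Qᵀ).mulVec := by
  intro v w hvw
  have e : (minOp H Q)ᵀ * Qᵀ = 1 := by rw [← transpose_mul, (kkt_mul_blocks H Q h).2.2.2, transpose_one]
  have := congrArg ((minOp H Q)ᵀ *ᵥ ·) hvw
  simpa only [mulVec_mulVec, e, one_mulVec] using this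

omit [DecidableEq κ] [Fintype κ] in
/-- [folklore] … equivalently `Q.vecMul` is injective. -/
theorem vecMul_injective (H : Matrix ν ν ℝ) (Q : Matrix μ ν ℝ) (h : IsUnit (kkt H Q).det) : Function.Injective Q.vecMul := by
  intro v w hvw
  apply transpose_mulVec_injective H Q h
  simpa only [mulVec_transpose] using hvw

omit [DecidableEq κ] [Fintype κ] in
/-- [folklore] **A PSD FINE FORM HAS A PSD EFFECTIVE FORM**: `H ⪰ 0`, bordering invertible ⟹ `effForm H Q = minOpᵀ·H·minOp ⪰ 0`. -/
theorem effForm_posSemidef (H : Matrix ν ν ℝ) (Q : Matrix μ ν ℝ) (hH : H.PosSemidef) (h : IsUnit (kkt H Q).det) :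
    (effForm H Q).PosSemidef := by
  have e := transpose_minOp_mul_mul_minOp H Q h
  rw [← conjTranspose_eq_transpose_of_trivial] at e
  rw [← e]; exact hH.conjTranspose_mul_mul_same (minOp H Q)

omit [DecidableEq κ] [Fintype κ] in
/-- [folklore] **A PD FINE FORM HAS A PD EFFECTIVE FORM**: `H ≻ 0`, bordering invertible ⟹ `blockProp H Q = QH⁻¹Qᵀ ≻ 0` and `effForm H Q = (QH⁻¹Qᵀ)⁻¹ ≻ 0`. -/
theorem effForm_posDef_of_posDef (H : Matrix ν ν ℝ) (Q : Matrix μ ν ℝ) (hH : H.PosDef) (h : IsUnit (kkt H Q).det) :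
    (blockProp H Q).PosDef ∧ (effForm H Q).PosDef := by
  have hHu : IsUnit H.det := (isUnit_iff_isUnit_det H).mp hH.isUnit
  have hbp : (blockProp H Q).PosDef := by
    have hP := hH.inv.mul_mul_conjTranspose_same (vecMul_injective H Q h)
    rwa [conjTranspose_eq_transpose_of_trivial] at hP
  have hPu : IsUnit (blockProp H Q).det := (isUnit_iff_isUnit_det _).mp hbp.isUnit
  refine ⟨hbp, ?_⟩
  rw [effForm_eq_blockProp_inv H Q hHu hPu]; exact hbp.inv

omit [DecidableEq ν] [DecidableEq κ] [Fintype κ] in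
/-- [folklore] a PSD real matrix kills every isotropic vector: `H ⪰ 0`, `xᵀHx = 0 ⟹ Hx = 0` (part 1's division-free Cauchy–Schwarz; no spectral theorem). -/
theorem mulVec_eq_zero_of_quadForm_eq_zero (H : Matrix ν ν ℝ) (hH : H.PosSemidef) {x : ν → ℝ} (hx : x ⬝ᵥ H *ᵥ x = 0) :
    H *ᵥ x = 0 := by
  have hcs := dotProduct_mulVec_sq_le H hH x (H *ᵥ x)
  rw [hx, mul_zero] at hcs
  have h0 : (H *ᵥ x) ⬝ᵥ H *ᵥ x = 0 := pow_eq_zero_iff two_ne_zero |>.mp (le_antisymm hcs (sq_nonneg _))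
  exact dotProduct_self_eq_zero.mp h0

omit [DecidableEq κ] [Fintype κ] in
/-- [folklore] with an invertible bordering, `ker H ∩ ker Q = 0`: `Hx = 0`, `Qx = 0 ⟹ x = 0` (`kkt·(x, 0) = 0`). -/
theorem eq_zero_of_mulVec_eq_zero (H : Matrix ν ν ℝ) (Q : Matrix μ ν ℝ) (h : IsUnit (kkt H Q).det) {x : ν → ℝ} (hHx : H *ᵥ x = 0)
    (hQx : Q *ᵥ x = 0) : x = 0 := by
  have hinj : Function.Injective (kkt H Q).mulVec := mulVec_injective_iff_isUnit.mpr ((isUnit_iff_isUnit_det _).mpr h)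
  have hk : kkt H Q *ᵥ Sum.elim x 0 = 0 := by
    rw [kkt_eq_fromBlocks, fromBlocks_mulVec]
    have e1 : (Sum.elim x (0 : μ → ℝ)) ∘ Sum.inl = x := rfl
    have e2 : (Sum.elim x (0 : μ → ℝ)) ∘ Sum.inr = 0 := rfl
    rw [e1, e2, hHx, hQx, mulVec_zero, mulVec_zero, add_zero, add_zero]
    funext i; cases i <;> rfl
  have := hinj (hk.trans (mulVec_zero _).symm)
  funext i
  simpa using congrFun this (Sum.inl i)

omit [DecidableEq κ] [Fintype κ] in
/-- [folklore] **FOR A PSD FINE FORM, THE EFFECTIVE FORM IS PD EXACTLY WHEN THE FINE FORM IS** (located): `H ⪰ 0`, bordering invertible ⟹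
(`effForm H Q ≻ 0 ⟺ H ≻ 0`).  (⟸: `(QH⁻¹Qᵀ)⁻¹`; ⟹: a vector `x ≠ 0` with `xᵀHx = 0` has `Hx = 0`, hence `Qx ≠ 0`, and the value at `a = Qx` is `≤ xᵀHx = 0`.) -/
theorem effForm_posDef_iff (H : Matrix ν ν ℝ) (Q : Matrix μ ν ℝ) (hH : H.PosSemidef) (h : IsUnit (kkt H Q).det) :
    (effForm H Q).PosDef ↔ H.PosDef := by
  refine ⟨fun hS => ?_, fun hpd => (effForm_posDef_of_posDef H Q hpd h).2⟩
  have hHs : Hᵀ = H := by rw [← conjTranspose_eq_transpose_of_trivial]; exact hH.1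
  have hker : ∀ z : ν → ℝ, Q *ᵥ z = 0 → 0 ≤ z ⬝ᵥ H *ᵥ z := fun z _ => by simpa using hH.dotProduct_mulVec_nonneg z
  refine PosDef.of_dotProduct_mulVec_pos hH.1 fun x hx => ?_
  rw [star_trivial]
  have h0 : 0 ≤ x ⬝ᵥ H *ᵥ x := by simpa using hH.dotProduct_mulVec_nonneg x
  rcases h0.lt_or_eq with hpos | hzero
  · exact hpos
  · exfalso
    have hHx : H *ᵥ x = 0 := mulVec_eq_zero_of_quadForm_eq_zero H hH hzero.symm
    by_cases hQx : Q *ᵥ x = 0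
    · exact hx (eq_zero_of_mulVec_eq_zero H Q h hHx hQx)
    · have hle := effForm_quadForm_le H Q hHs h hker (Q *ᵥ x) x rfl
      have hlt : 0 < (Q *ᵥ x) ⬝ᵥ effForm H Q *ᵥ (Q *ᵥ x) := by simpa using hS.dotProduct_mulVec_pos hQx
      linarith

/-! ### The counterexample: positivity on `ker Q` alone does not make the effective form positive
(`H = diag(−1, 1)`, `Q = (1 0)`, written out — no `def`, so the file stays in the kernel lane) -/

section Example

/-- [folklore] `diag(−1,1)` is its own inverse. -/
theorem example_inv : (!![-1, 0; 0, 1] : Matrix (Fin 2) (Fin 2) ℝ)⁻¹ = !![-1, 0; 0, 1] := by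
  refine Matrix.inv_eq_left_inv ?_
  ext i j; fin_cases i <;> fin_cases j <;> norm_num [Matrix.mul_apply, Fin.sum_univ_two]

/-- [folklore] `det diag(−1,1) = −1` is a unit. -/
theorem example_hHu : IsUnit (!![-1, 0; 0, 1] : Matrix (Fin 2) (Fin 2) ℝ).det := by rw [Matrix.det_fin_two]; norm_num

/-- [folklore] `blockProp diag(−1,1) (1 0) = QH⁻¹Qᵀ = (−1)`. -/
theorem example_blockProp : blockProp (!![-1, 0; 0, 1] : Matrix (Fin 2) (Fin 2) ℝ) (!![1, 0] : Matrix (Fin 1) (Fin 2) ℝ) = !![(-1 : ℝ)] := by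
  rw [blockProp, example_inv]
  ext i j; fin_cases i; fin_cases j
  norm_num [Matrix.mul_apply, Fin.sum_univ_two, Matrix.transpose_apply]

/-- [folklore] … which is invertible. -/
theorem example_hPu : IsUnit (blockProp (!![-1, 0; 0, 1] : Matrix (Fin 2) (Fin 2) ℝ) (!![1, 0] : Matrix (Fin 1) (Fin 2) ℝ)).det := by
  rw [example_blockProp, Matrix.det_fin_one]; norm_num

/-- [folklore] the bordering `kkt diag(−1,1) (1 0)` is invertible (`Composition.det_kkt_ne_zero`). -/
theorem example_hkkt : IsUnit (kkt (!![-1, 0; 0, 1] : Matrix (Fin 2) (Fin 2) ℝ) (!![1, 0] : Matrix (Fin 1) (Fin 2) ℝ)).det :=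
  isUnit_iff_ne_zero.mpr
    (Literature.MathematicalPhysics.QuantumFieldTheory.Balaban1983to89.Beta.Composition.det_kkt_ne_zero _ _ example_hHu example_hPu)

/-- [folklore] `diag(−1,1) ⪰ 0` (indeed `≻ 0`) ON `ker (1 0) = span e₂`: `Qz = 0 ⟹ z₀ = 0`, `zᵀHz = z₁²`. -/
theorem example_hker : ∀ z : Fin 2 → ℝ, (!![1, 0] : Matrix (Fin 1) (Fin 2) ℝ) *ᵥ z = 0 →
    0 ≤ z ⬝ᵥ (!![-1, 0; 0, 1] : Matrix (Fin 2) (Fin 2) ℝ) *ᵥ z := by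
  intro z hz
  have h0 : z 0 = 0 := by
    have := congrFun hz 0
    simpa [Matrix.mulVec, dotProduct, Fin.sum_univ_two] using this
  simp [Matrix.mulVec, dotProduct, Fin.sum_univ_two, h0]
  nlinarith

/-- [folklore] **`effForm diag(−1,1) (1 0) = (−1)`**: the constrained minimum `min{−φ₀² + φ₁² : φ₀ = a} = −a²` is NEGATIVE. -/
theorem example_effForm : effForm (!![-1, 0; 0, 1] : Matrix (Fin 2) (Fin 2) ℝ) (!![1, 0] : Matrix (Fin 1) (Fin 2) ℝ) = !![(-1 : ℝ)] := by
  rw [effForm_eq_blockProp_inv _ _ example_hHu example_hPu, example_blockProp]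
  refine Matrix.inv_eq_left_inv ?_
  ext i j; fin_cases i; fin_cases j; norm_num [Matrix.mul_apply]

/-- [folklore] **… so «`H ⪰ 0` on `ker Q` + invertible bordering» does NOT make `effForm` positive semidefinite** (it gives the minimum reading of §1,
with a possibly negative minimum; positivity needs `H ⪰ 0`, §2). -/
theorem example_not_posSemidef :
    ¬ (effForm (!![-1, 0; 0, 1] : Matrix (Fin 2) (Fin 2) ℝ) (!![1, 0] : Matrix (Fin 1) (Fin 2) ℝ)).PosSemidef := by
  intro hS
  have h0 : 0 ≤ (effForm (!![-1, 0; 0, 1] : Matrix (Fin 2) (Fin 2) ℝ) (!![1, 0] : Matrix (Fin 1) (Fin 2) ℝ)) 0 0 := hS.diag_nonneg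
  rw [example_effForm] at h0
  norm_num at h0

end Example

/-! ## §3 The ε-regularised Schur complement -/

omit [Fintype ν] [Fintype μ] [DecidableEq μ] [DecidableEq κ] [Fintype κ] in
/-- [folklore] bordering the regularised form: `kkt (H + ε•1) Q = kkt H Q + ε•[[1,0],[0,0]]`. -/
theorem kkt_add_smul_one (H : Matrix ν ν ℝ) (Q : Matrix μ ν ℝ) (ε : ℝ) :
    kkt (H + ε • (1 : Matrix ν ν ℝ)) Q = kkt H Q + ε • Matrix.fromBlocks 1 0 0 0 := by
  rw [kkt_eq_fromBlocks, kkt_eq_fromBlocks, Matrix.fromBlocks_smul, Matrix.fromBlocks_add]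
  simp

omit [DecidableEq κ] [Fintype κ] in
/-- [folklore] **CONTINUITY OF THE EFFECTIVE FORM IN THE REGULARISATION**: with the bordering of `H` invertible (nothing else),
`effForm (H + ε•1) Q → effForm H Q` as `ε → 0` (Mathlib `continuousAt_matrix_inv` at `kkt H Q`, the scalar socket `Ring.inverse` being continuous at the unit `det kkt`). -/
theorem tendsto_effForm_add_smul (H : Matrix ν ν ℝ) (Q : Matrix μ ν ℝ) (h : IsUnit (kkt H Q).det) :
    Tendsto (fun ε : ℝ => effForm (H + ε • (1 : Matrix ν ν ℝ)) Q) (𝓝 0) (𝓝 (effForm H Q)) := by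
  have hc : Tendsto (fun ε : ℝ => kkt (H + ε • (1 : Matrix ν ν ℝ)) Q) (𝓝 0) (𝓝 (kkt H Q)) := by
    simp_rw [kkt_add_smul_one]
    have : Tendsto (fun ε : ℝ => kkt H Q + ε • Matrix.fromBlocks (1 : Matrix ν ν ℝ) 0 0 (0 : Matrix μ μ ℝ)) (𝓝 0)
        (𝓝 (kkt H Q + (0 : ℝ) • Matrix.fromBlocks (1 : Matrix ν ν ℝ) 0 0 (0 : Matrix μ μ ℝ))) :=
      tendsto_const_nhds.add (tendsto_id.smul tendsto_const_nhds)
    simpa using this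
  have hdet : ContinuousAt Ring.inverse (kkt H Q).det := by
    obtain ⟨u, hu⟩ := h
    rw [← hu]
    exact NormedRing.inverse_continuousAt u
  have hi := (continuousAt_matrix_inv (kkt H Q) hdet).tendsto.comp hc
  have hp : Continuous (fun M : Matrix (ν ⊕ μ) (ν ⊕ μ) ℝ => -M.toBlocks₂₂) := by
    refine Continuous.neg (continuous_matrix fun i j => ?_)
    show Continuous fun M : Matrix (ν ⊕ μ) (ν ⊕ μ) ℝ => M (Sum.inr i) (Sum.inr j)
    exact (continuous_apply _).comp (continuous_apply _)
  exact (hp.tendsto _).comp hi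

omit [DecidableEq κ] [Fintype κ] in
/-- [folklore] for a PSD fine form and `0 < ε`, the regularised form `H + ε•1` and its Schur complement `blockProp (H + ε•1) Q = Q(H + ε)⁻¹Qᵀ` are
positive definite, hence invertible (the bordering of `H` supplies `Qᵀ` injective). -/
theorem isUnit_reg_of_posSemidef (H : Matrix ν ν ℝ) (Q : Matrix μ ν ℝ) (hH : H.PosSemidef) (h : IsUnit (kkt H Q).det) {ε : ℝ}
    (hε : 0 < ε) :
    IsUnit (H + ε • (1 : Matrix ν ν ℝ)).det ∧ IsUnit (blockProp (H + ε • (1 : Matrix ν ν ℝ)) Q).det := by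
  have hpd : (H + ε • (1 : Matrix ν ν ℝ)).PosDef := PosDef.posSemidef_add hH (posDef_smul_of_pos 1 PosDef.one hε)
  have hHu : IsUnit (H + ε • (1 : Matrix ν ν ℝ)).det := (isUnit_iff_isUnit_det _).mp hpd.isUnit
  have hbp : (blockProp (H + ε • (1 : Matrix ν ν ℝ)) Q).PosDef := by
    have hP := hpd.inv.mul_mul_conjTranspose_same (vecMul_injective H Q h)
    rwa [conjTranspose_eq_transpose_of_trivial] at hP
  exact ⟨hHu, (isUnit_iff_isUnit_det _).mp hbp.isUnit⟩

omit [DecidableEq κ] [Fintype κ] in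
/-- [folklore] **THE EFFECTIVE FORM OF A SINGULAR PSD FINE FORM IS THE LIMIT OF THE REGULARISED SCHUR COMPLEMENTS**: `H ⪰ 0`, bordering invertible ⟹
`(Q (H + ε•1)⁻¹ Qᵀ)⁻¹ → effForm H Q` as `ε ↓ 0` (each term `= effForm (H + ε•1) Q` by `CompositionSingular.effForm_eq_blockProp_inv`). -/
theorem tendsto_blockProp_inv_of_posSemidef (H : Matrix ν ν ℝ) (Q : Matrix μ ν ℝ) (hH : H.PosSemidef) (h : IsUnit (kkt H Q).det) :
    Tendsto (fun ε : ℝ => (blockProp (H + ε • (1 : Matrix ν ν ℝ)) Q)⁻¹) (𝓝[>] 0) (𝓝 (effForm H Q)) := by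
  have h1 := (tendsto_effForm_add_smul H Q h).mono_left (nhdsWithin_le_nhds (s := Set.Ioi (0 : ℝ)))
  refine h1.congr' ?_
  filter_upwards [self_mem_nhdsWithin] with ε hε
  obtain ⟨hHu, hPu⟩ := isUnit_reg_of_posSemidef H Q hH h (Set.mem_Ioi.mp hε)
  exact effForm_eq_blockProp_inv _ Q hHu hPu

/-! ## §4 The composition law as nested minimisation (the coarse-form semigroup in variational clothing) -/

/-- [folklore] **TWO STEPS = ONE STEP, AS MINIMA**: with `𝒮₁ := effForm H Q₁`, both borderings invertible, `𝒮₁ + G` symmetric and `⪰ 0` on `ker Q₂`,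
the two-step value `bᵀ·effForm (H + Q₁ᵀGQ₁) (Q₂Q₁)·b` is the LEAST value of `aᵀ(𝒮₁ + G)a` over `Q₂a = b` (`CompositionSingular.effForm_compForm` + `isLeast_effForm`):
integrating out the fine field and then the block field is one constrained minimisation of the effective-plus-step form. -/
theorem isLeast_effForm_comp (H : Matrix ν ν ℝ) (Q₁ : Matrix μ ν ℝ) (G : Matrix μ μ ℝ) (Q₂ : Matrix κ μ ℝ)
    (h₁ : IsUnit (kkt H Q₁).det) (h₂ : IsUnit (kkt (effForm H Q₁ + G) Q₂).det) (hsymm : (effForm H Q₁ + G)ᵀ = effForm H Q₁ + G)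
    (hker₂ : ∀ a : μ → ℝ, Q₂ *ᵥ a = 0 → 0 ≤ a ⬝ᵥ (effForm H Q₁ + G) *ᵥ a) (b : κ → ℝ) :
    IsLeast {t : ℝ | ∃ a : μ → ℝ, Q₂ *ᵥ a = b ∧ t = a ⬝ᵥ (effForm H Q₁ + G) *ᵥ a}
      (b ⬝ᵥ effForm (compForm H Q₁ G) (Q₂ * Q₁) *ᵥ b) := by
  rw [effForm_compForm H Q₁ G Q₂ h₁ h₂]
  exact isLeast_effForm _ Q₂ hsymm h₂ hker₂ b

omit [DecidableEq κ] [Fintype κ] in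
/-- [folklore] the symmetry letter of §4 from symmetric data: `Hᵀ = H`, `Gᵀ = G ⟹ (effForm H Q₁ + G)ᵀ = effForm H Q₁ + G`. -/
theorem transpose_effForm_add (H : Matrix ν ν ℝ) (Q₁ : Matrix μ ν ℝ) (G : Matrix μ μ ℝ) (hH : Hᵀ = H) (hG : Gᵀ = G) :
    (effForm H Q₁ + G)ᵀ = effForm H Q₁ + G := by
  rw [transpose_add, (minOpL_eq_transpose H Q₁ hH).2.2, hG]

end Summit.QuantumFields.BalabanUV.Beta.FP.CoarseFormSemigroup

end
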